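/- Free-seat work of EXTRA WIDTH SEAT `ym-line-cbag-p1-w4` (prover-ym-line-cbag-p1-w4-g2-0), route `EguchiKawaiDirectionLadder`
(ideator ym-idea-2, LINE 8), crux `TripleSmallBallMargin` (stmt-QuantumFields-27724), toward stub (b) `OffBlockDecoupling`
(ingredient 1 «class-function reduction in the first link» of the honest reduction (b♯) in the sizing note
`sizing-27724-stubB.md`; general `d`, complementing w2's pair version `haar_pair_conj`).  ROUTE-INDEPENDENT (no Theses
import).  Nothing here bears on the Yang–Mills mass gap. -/
import Summits.QuantumFields.YangMills.Theorems.EguchiKawaiDirectionLadderHaarAbsorption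
import HarnessLib

/-!
# Route `EguchiKawaiDirectionLadder`: Fubini over the first link and the class-function reduction

* `measurePreserving_piFinSuccAbove_zero` — `U ↦ (U 0, (U_{j+1})_j)` carries `ekHaar (d+1) N` to `Haar ⊗ ekHaar d N`
  (Mathlib's `measurePreserving_piFinSuccAbove` at `i = 0`);
* `ekHaar_succ_eq_lintegral_firstFibre` — `ekHaar (d+1) N E = ∫ ekHaar d N {W | Fin.cons U₀ W ∈ E} dHaar(U₀)`;
* `ekHaar_succ_le_of_firstFibre` — a uniform bound on the first-link fibres bounds the event;
* `firstFibre_conj` — for an event invariant under SIMULTANEOUS CONJUGATION (e.g. `Sym_δ ∩ {S_R ≤ t}`,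
  `conj_preimage_symSmallBall`, or any event defined through the spectrum of `U 0`), the fibre over `V U₀ V⁻¹` has
  the same `ekHaar d N`-measure as the fibre over `U₀` (`measurePreserving_conj_ekHaar`): with w2's
  `exists_unitary_conj_eq_diagonal` every first-link fibre is the fibre over a DIAGONAL first link — the eigenbasis in
  which the blocks / windows of the within-band level are defined.

HONEST FRAMING: measure-theoretic bookkeeping only.  The route bears on the barrier-ledger fact `EguchiKawaiBreakdown`.
-/

set_option autoImplicit false

noncomputable section

open MeasureTheory
open scoped ENNReal
open Literature.Barriers.QuantumFields

namespace Summit.QuantumFields.YangMills.Theorems.EguchiKawaiDirectionLadder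

variable {d N : ℕ}

/- The split `U ↦ (U 0, (U (j+1))_j)` is Mathlib's measurable equivalence
`MeasurableEquiv.piFinSuccAbove (fun _ : Fin (d + 1) => UN N) 0 : EKConfig (d + 1) N ≃ᵐ UN N × EKConfig d N`
(written out in full below; no abbreviation is introduced). -/

/-- The inverse of the split is `Fin.cons`. -/
theorem piFinSuccAbove_zero_symm_apply (U₀ : UN N) (W : EKConfig d N) :
    (MeasurableEquiv.piFinSuccAbove (fun _ : Fin (d + 1) => UN N) 0).symm (U₀, W) =
      (Fin.cons U₀ W : EKConfig (d + 1) N) := by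
  show (Fin.insertNth 0 U₀ W : EKConfig (d + 1) N) = Fin.cons U₀ W
  exact Fin.insertNth_zero' U₀ W

/-- **The split is measure preserving**: `ekHaar (d+1) N ↦ Haar ⊗ ekHaar d N`. -/
theorem measurePreserving_piFinSuccAbove_zero (d N : ℕ) :
    MeasurePreserving (MeasurableEquiv.piFinSuccAbove (fun _ : Fin (d + 1) => UN N) 0) (ekHaar (d + 1) N)
      ((Literature.MathematicalPhysics.QuantumFieldTheory.haarProbability (UN N)).prod (ekHaar d N)) := by
  unfold ekHaar
  exact measurePreserving_piFinSuccAbove (fun _ : Fin (d + 1) => _) 0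

/-- `Fin.cons U₀` is measurable in the tail. -/
theorem measurable_cons (U₀ : UN N) : Measurable fun W : EKConfig d N => (Fin.cons U₀ W : EKConfig (d + 1) N) := by
  have h : (fun W : EKConfig d N => (Fin.cons U₀ W : EKConfig (d + 1) N)) =
      (MeasurableEquiv.piFinSuccAbove (fun _ : Fin (d + 1) => UN N) 0).symm ∘ fun W => (U₀, W) := by
    funext W; rw [Function.comp_apply, piFinSuccAbove_zero_symm_apply]
  rw [h]
  exact (MeasurableEquiv.piFinSuccAbove (fun _ : Fin (d + 1) => UN N) 0).symm.measurable.comp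
    (measurable_const.prodMk measurable_id)

/-- The first-link fibre of a measurable event is measurable. -/
theorem measurableSet_firstFibre {E : Set (EKConfig (d + 1) N)} (hE : MeasurableSet E) (U₀ : UN N) :
    MeasurableSet {W : EKConfig d N | (Fin.cons U₀ W : EKConfig (d + 1) N) ∈ E} :=
  measurable_cons U₀ hE

/-- **Fubini over the first link**: `ekHaar (d+1) N E = ∫ ekHaar d N {W | Fin.cons U₀ W ∈ E} dHaar(U₀)`. -/
theorem ekHaar_succ_eq_lintegral_firstFibre {E : Set (EKConfig (d + 1) N)} (hE : MeasurableSet E) :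
    ekHaar (d + 1) N E =
      ∫⁻ U₀, ekHaar d N {W : EKConfig d N | (Fin.cons U₀ W : EKConfig (d + 1) N) ∈ E}
        ∂(Literature.MathematicalPhysics.QuantumFieldTheory.haarProbability (UN N)) := by
  set Φ := MeasurableEquiv.piFinSuccAbove (fun _ : Fin (d + 1) => UN N) 0 with hΦ
  have hmp : MeasurePreserving Φ (ekHaar (d + 1) N)
      ((Literature.MathematicalPhysics.QuantumFieldTheory.haarProbability (UN N)).prod (ekHaar d N)) :=
    measurePreserving_piFinSuccAbove_zero d N
  have hE' : MeasurableSet (Φ.symm ⁻¹' E) := Φ.symm.measurable hE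
  have h1 : ekHaar (d + 1) N E = ekHaar (d + 1) N (Φ ⁻¹' (Φ.symm ⁻¹' E)) := by
    congr 1; ext U; simp
  rw [h1, hmp.measure_preimage hE'.nullMeasurableSet, Measure.prod_apply hE']
  refine lintegral_congr fun U₀ => ?_
  congr 1
  ext W
  simp only [Set.mem_preimage, Set.mem_setOf_eq]
  rw [hΦ, piFinSuccAbove_zero_symm_apply]

/-- **Uniform fibre bound**: if every first-link fibre has `ekHaar d N`-measure `≤ b`, then `ekHaar (d+1) N E ≤ b`. -/
theorem ekHaar_succ_le_of_firstFibre {E : Set (EKConfig (d + 1) N)} (hE : MeasurableSet E) (b : ℝ≥0∞)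
    (h : ∀ U₀ : UN N, ekHaar d N {W : EKConfig d N | (Fin.cons U₀ W : EKConfig (d + 1) N) ∈ E} ≤ b) :
    ekHaar (d + 1) N E ≤ b := by
  rw [ekHaar_succ_eq_lintegral_firstFibre hE]
  calc ∫⁻ U₀, ekHaar d N {W : EKConfig d N | (Fin.cons U₀ W : EKConfig (d + 1) N) ∈ E}
        ∂(Literature.MathematicalPhysics.QuantumFieldTheory.haarProbability (UN N))
      ≤ ∫⁻ _, b ∂(Literature.MathematicalPhysics.QuantumFieldTheory.haarProbability (UN N)) :=
        lintegral_mono fun U₀ => h U₀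
    _ = b := by rw [lintegral_const, measure_univ, mul_one]

/-- **Fibre bound with a first-link event**: if the fibres over `U₀ ∈ A` are `≤ b` and `E` only has points with
`U 0 ∈ A`, then `ekHaar (d+1) N E ≤ b · Haar(A)`. -/
theorem ekHaar_succ_le_of_firstFibre_on {E : Set (EKConfig (d + 1) N)} (hE : MeasurableSet E) {A : Set (UN N)}
    (hA : MeasurableSet A) (b : ℝ≥0∞)
    (h : ∀ U₀ ∈ A, ekHaar d N {W : EKConfig d N | (Fin.cons U₀ W : EKConfig (d + 1) N) ∈ E} ≤ b)
    (hEA : ∀ U ∈ E, U 0 ∈ A) :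
    ekHaar (d + 1) N E ≤ b * Literature.MathematicalPhysics.QuantumFieldTheory.haarProbability (UN N) A := by
  rw [ekHaar_succ_eq_lintegral_firstFibre hE]
  calc ∫⁻ U₀, ekHaar d N {W : EKConfig d N | (Fin.cons U₀ W : EKConfig (d + 1) N) ∈ E}
        ∂(Literature.MathematicalPhysics.QuantumFieldTheory.haarProbability (UN N))
      ≤ ∫⁻ U₀, A.indicator (fun _ => b) U₀
          ∂(Literature.MathematicalPhysics.QuantumFieldTheory.haarProbability (UN N)) := by
        refine lintegral_mono fun U₀ => ?_
        by_cases hU : U₀ ∈ A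
        · rw [Set.indicator_of_mem hU]; exact h U₀ hU
        · rw [Set.indicator_of_notMem hU]
          have : {W : EKConfig d N | (Fin.cons U₀ W : EKConfig (d + 1) N) ∈ E} = ∅ := by
            ext W
            simp only [Set.mem_setOf_eq, Set.mem_empty_iff_false, iff_false]
            intro hW
            exact hU (by simpa using hEA _ hW)
          rw [this, measure_empty]
    _ = b * Literature.MathematicalPhysics.QuantumFieldTheory.haarProbability (UN N) A :=
        lintegral_indicator_const hA b

/-- Simultaneous conjugation of a `Fin.cons` configuration. -/
theorem conj_cons (V U₀ : UN N) (W : EKConfig d N) :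
    (fun μ => V * (Fin.cons U₀ W : EKConfig (d + 1) N) μ * V⁻¹) =
      (Fin.cons (V * U₀ * V⁻¹) (fun μ => V * W μ * V⁻¹) : EKConfig (d + 1) N) := by
  funext μ
  refine Fin.cases ?_ (fun j => ?_) μ
  · simp
  · simp

/-- **Class-function reduction in the first link**: for an event `E` invariant under simultaneous conjugation,
the fibre over `V U₀ V⁻¹` has the same measure as the fibre over `U₀`.  (With w2's `exists_unitary_conj_eq_diagonal`:
every fibre is the fibre over a diagonal first link.) -/
theorem firstFibre_conj {E : Set (EKConfig (d + 1) N)} (hE : MeasurableSet E)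
    (hconj : ∀ (V : UN N) (U : EKConfig (d + 1) N), U ∈ E → (fun μ => V * U μ * V⁻¹) ∈ E) (V U₀ : UN N) :
    ekHaar d N {W : EKConfig d N | (Fin.cons (V * U₀ * V⁻¹) W : EKConfig (d + 1) N) ∈ E} =
      ekHaar d N {W : EKConfig d N | (Fin.cons U₀ W : EKConfig (d + 1) N) ∈ E} := by
  have hset : {W : EKConfig d N | (Fin.cons (V * U₀ * V⁻¹) W : EKConfig (d + 1) N) ∈ E} =
      (fun W : EKConfig d N => fun μ => V⁻¹ * W μ * V⁻¹⁻¹) ⁻¹'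
        {W : EKConfig d N | (Fin.cons U₀ W : EKConfig (d + 1) N) ∈ E} := by
    ext W
    simp only [Set.mem_setOf_eq, Set.mem_preimage, inv_inv]
    constructor
    · intro hW
      have h := hconj V⁻¹ _ hW
      rw [conj_cons] at h
      simpa [mul_assoc] using h
    · intro hW
      have h := hconj V _ hW
      rw [conj_cons] at h
      simpa [mul_assoc] using h
  rw [hset]
  exact (measurePreserving_conj_ekHaar (d := d) V⁻¹).measure_preimage
    (measurableSet_firstFibre hE U₀).nullMeasurableSet

/-- The centre-symmetric small-ball event `Sym_δ ∩ {S_R ≤ t}` is invariant under simultaneous conjugation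
(the hypothesis `hconj` of `firstFibre_conj`). -/
theorem symSmallBall_conj_invariant (δ t : ℝ) (V : UN N) (U : EKConfig (d + 1) N)
    (hU : U ∈ ekSymRegion (d + 1) N δ ∩ {U | ekAction U ≤ t}) :
    (fun μ => V * U μ * V⁻¹) ∈ ekSymRegion (d + 1) N δ ∩ {U | ekAction U ≤ t} := by
  rw [← conj_preimage_symSmallBall V δ t] at hU
  exact hU

end Summit.QuantumFields.YangMills.Theorems.EguchiKawaiDirectionLadder

end
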